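import Summits.ResolutionOfSingularities.ResolutionOfSingularities.Theorems.KangarooCutCells
import Summits.ResolutionOfSingularities.ResolutionOfSingularities.Theorems.MaxContactCutTameCut
import HarnessLib

/-!
# MaxContactCutKangarooCut — decomp-res node «KangarooCut» (lens-4 g24, critic rows 148/148a), tree file 5/5 of the node

Content VERBATIM from the decomp-res lens-4 g24 TREE-FACING COMPANION
`HOME/decomp-res-lens-4/g24/tree/KangarooCutTree.lean` (sha256 76e53063…, 770 l;
HOME = run/shared/lean/pub/decomp-res) = the NEW PART §60–§63 of the node
`HOME/decomp-res-lens-4/g24/KangarooCut.lean` (pin f422af60, l. 1026–1759, byte-identical);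
the node's carried g23 block «FrobeniusForm» is ALREADY in the tree as `Theorems/FrobeniusGain` ·
`PPowerFormLucas` · `PPowerForm` · `PPowerTowers` and is not
landed again.  Critic: CRITIC-LEDGER rows 148 (CLEARED, DECIDED +1: the jump-free bed ⊆ `ContactHugging`) and 148a
(the companion = the landing unit); landing
order 2026-08-30T22:00:50Z / 22:19:25Z.  Landed by decomp-res writer g8 in the lens's namespace
`…Theorems.HugValuationCut`, split CONE-AWARE for the
400-line limit: `PPowerSpan` (§60) · `KangarooTransport` (§61) · `KangarooTowers` (§62) · `KangarooCutCells`
(§63 minus the three 31571 up-links) are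
OUTSIDE the Theses cone (importable by the route file); `MaxContactCutKangarooCut` (§63's three `_of_item` up-links
from `MaxContactCut.NoContactHuggingTowers`)
is the in-cone wiring file.  All `--supports stmt-ResolutionOfSingularities-28338`.  Aside bookkeeping (critic row
148 / rider 22:00:50Z (3)): exactly ONE
successor aside `NoWildKangarooOffLocusTowers` (home `KangarooCutCells`) SUPERSEDES 28338
`LCNoWildContactFreeOffLocusTowers` once this node and
`Theorems/ContactFreeIsPPower` (lens-6 g19 companion, every-field iff `noWildContactFreeOffLocusTowers_iff_pPower`)
are both in the tree — exactness chain
`noWildContactFreeOffLocusTowers_iff_pPower` + `noWildPPowerOffLocusTowers_iff_kangaroo (h31571)`.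

§63 (companion l. 634–765), IN-CONE PART: the three up-links from the MaxContactCut item 31571
`MaxContactCut.NoContactHuggingTowers` BY NAME —
`noWildPPowerJumpFreeOffLocusTowers_of_item`, `noWildPPowerOffLocusTowers_iff_kangaroo (h71)`,
`noWildContactFreeOffLocusTowers_iff_g24_of_item (h71)`.
Imports `KangarooCutCells` + the cone module `MaxContactCutTameCut` (as the companion).  INSIDE the Theses cone
(wiring file; never imported by the route file).

[WRITER NOTE (decomp-res writer g8): section split only; namespace, universes, section variables and every
declaration exactly as in the companion
(global `set_option` dropped; the cone import `MaxContactCutTameCut` of the companion is replaced in the cone-free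
files by the cone-free homes of what the
proofs use: `AbsoluteGiraudKernel` (`AbsoluteContactClasses.point_round_chart`),
`FrobeniusLadderFInjectiveMacaulayficationCentreSpread` (`centreSpread`),
`PPowerTowers`, `TameCutStage`, `LatencyCutCells`; the `open …Theses` line lives only in the wiring file).]

(Sources: Hauser2010Kangaroo; Moh1987; Hironaka1970Additive; Giraud1975; CossartPiltant2008 Prop. 4.2;
CossartPiltant2019 Prop. 2.50; EGA IV₄ 16.11.2.)
-/

noncomputable section

open CategoryTheory AlgebraicGeometry IsLocalRing
open Literature.AlgebraicGeometry.Resolution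
open Summit.ResolutionOfSingularities.ResolutionOfSingularities.Theses
open Summit.ResolutionOfSingularities.ResolutionOfSingularities.Theorems
open WeakOrderReduction ForcedTowerClasses DivergentTowerClasses MonomialTowerClasses
open HugDimensionClasses HugDimensionKernels SurfaceShadowClasses SurfaceShadowKernels
open NearPointCut (SingularClass)
open AbsoluteContactClasses (IsAbsContactAt SepResidueAt diffIdeal_restrict_le stalkMap_comp_toStalk_eq_stalkHom)
open scoped BigOperators

namespace Summit.ResolutionOfSingularities.ResolutionOfSingularities.Theorems.HugValuationCut

/-! ## §63 (g24 · NEW) THE CUT OF THE g23 LOCATED RESIDUAL BY THE KANGAROO LAW — cells and EXACT re-locations BY NAME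

`WildPPowerOffLocusTowersTerminate n` (g23: wild, off-locus singular class, `p`-power form at every marked point) ⟺
(EVENTUALLY JUMP-FREE bed — DECIDED: ⊆ `ContactHugging` by `contactHugging_of_eventuallyJumpFree`, hence settled by
`ContactHuggingTowersTerminate n` / 31571 BY NAME, no port) ∧ (KANGAROO-RECURRENT bed — THE LOCATED RESIDUAL
after g24: a typed
kangaroo jump interrupts EVERY germ from EVERY stage; by `exists_wInv_every_stage_of_pPowerTower` this is, at weight `p` over a
perfect field, literally «infinitely many kangaroo jumps along every weak-contact hypersurface», and at the
weights `2p, 3p, …`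
it contains the towers whose `p`-power forms are `p`-th powers of forms of HIGHER degree — no linear weak contact at all). -/

section KangarooCells

/-- **THE JUMP-FREE BED FROM 31571 BY NAME** (`MaxContactCut.NoContactHuggingTowers`, no port). [folklore] -/
theorem noWildPPowerJumpFreeOffLocusTowers_of_item (h : MaxContactCut.NoContactHuggingTowers) :
    NoWildPPowerJumpFreeOffLocusTowers :=
  fun n hn => wildPPowerJumpFree_of_contact (h n hn)

/-- **EXACT GIVEN 31571 BY NAME: the g23 residual ⟺ the kangaroo-recurrent bed.** [folklore] -/
theorem noWildPPowerOffLocusTowers_iff_kangaroo (h71 : MaxContactCut.NoContactHuggingTowers) :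
    NoWildPPowerOffLocusTowers ↔ NoWildKangarooOffLocusTowers := by
  rw [noWildPPowerOffLocusTowers_iff_g24]
  exact ⟨fun h => h.2, fun h => ⟨noWildPPowerJumpFreeOffLocusTowers_of_item h71, h⟩⟩

/-- **GIVEN 31571 BY NAME, the tree aside ⟺ (kangaroo-recurrent bed) ∧ (non-`p`-power contact-free bed).** [folklore] -/
theorem noWildContactFreeOffLocusTowers_iff_g24_of_item (h71 : MaxContactCut.NoContactHuggingTowers) :
    NoWildContactFreeOffLocusTowers ↔ NoWildKangarooOffLocusTowers ∧ NoWildContactFreeNonPPowerOffLocusTowers := by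
  rw [noWildContactFreeOffLocusTowers_iff_g23, noWildPPowerOffLocusTowers_iff_kangaroo h71]

end KangarooCells

end Summit.ResolutionOfSingularities.ResolutionOfSingularities.Theorems.HugValuationCut
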